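/-
Copyright (c) 2026 the pub-hodgecm-mathlib formalisation cell (harness21).  Prover seat hodgecm-mathlib-F0P2-p10 (g0) (re-dealt to strike line L1 by
director s1969 (b) ∕ s1970, LEAD F0P6-plan (g14) EMIT #1 «p21 file»), Track B «K2-LIT», #184♮ = hLiu418 = `stmt-HodgeConjecture-24832`;
Road I v3, S5-F3 lineage ∕ I4-conv (F′-fact), FILE C part 1: the LOCAL line-bridge dictionary `U(J)(L⁺_v) ≃ H₁(L⁺_v)` (Borel ↦ Siegel, `det_Δ`, `K ↦ K`).
-/
import Literature.NumberTheory.K2Lit.LocalDoublingSiegel                                     -- ★ D7c: `siegelDeltaLoc`, `mem_siegelDeltaLoc_iff_isSiegelM`, `localDetDelta_eq_detDeltaM` (+ ★ D1 `localSiegelCharacter`)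
import Summits.HodgeConjecture.HodgeConjecture.Theorems.K2E1BorelEisensteinU2FromK2Liu      -- ★ the GLOBAL line bridge: `bridge_congr`, `finSumFinEquiv_inl_zero`∕`_inr_zero`
import Literature.NumberTheory.Automorphic.UnitaryGroupLocalCongr                           -- ★ «D5» `UnitaryGroup.localCongr` (`u ↦ S_v u S_v⁻¹`), `coe_localCongr_apply_apply`
import HarnessLib

/-!
# Crux `HLiu418`, Road I v3, I4-conv (F′-fact), FILE C part 1 — `K2LiuLineBridgeLocalDictionary`:
# THE LOCAL LINE BRIDGE `κ : U(J)(L⁺_v) ≃ₜ* H₁(L⁺_v)`, `κ(x)_w = S_w x_w S_w⁻¹` — BOREL `↦` SIEGEL PARABOLIC, `det_Δ(h) = b₀₀`, `K ↦ K`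

Cell `hodgecm-mathlib`, crux item hLiu418 = `stmt-HodgeConjecture-24832`; squad K2 ∕ K2Liu; LEAD F0P6-plan (g14) EMIT #1 («p21 file» I4-conv C
`K2LiuKlingenInnerSectionSpherical`, director s1970 «p10 → the p21 file»); spec = K2Liu-p14 (g3) census 889e5ba8cd056cf7 §2 FILE C; prover F0P2-p10 (g0).
This is the ≤ 400-line first half of FILE C (the dictionary); the heads are `K2LiuKlingenInnerSectionSpherical` (imports this file).
THEOREMS ONLY (no `def`, no instance, no notation, no named-fact hypothesis, no `sorry`); lane `--supports stmt-HodgeConjecture-24832 --as helper` (count-neutral).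

THE POINT.  ★ `K2E1BorelEisensteinU2FromK2Liu` is the GLOBAL dictionary between the route's split hermitian plane `U(J)` (`J = antidiag(1,1)`, Borel = upper
triangular) and the doubled LINE `H₁ = U(𝕍₁ ⊕ −𝕍₁)`, `𝕍₁ = (L, 1)` (frame `e = Equiv.prodUnique (Fin 1) (Fin 1)`, `dV = dW = 1`; Siegel parabolic `P_Δ`) along
`Ψ_S g = S g S⁻¹`, `S = (1 ½; 1 −½)`.  This file is its PLACE-`v` form, typed on the doubled-line side `h ∈ H₁(L⁺_v)` (index `1 + 1`, the currency of ★ D7c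
`siegelDeltaLoc`∕`LambdaLoc` and ★ D1∕D10) with `b = κ⁻¹ h ∈ U(J)(L⁺_v)` (tree type `UnitaryGroup.localPi L c 2 J v`), for ANY topological-group isomorphism
`κ : U(J)(L⁺_v) ≃ₜ* H₁(L⁺_v)` whose components are conjugation by `S_w` (binder `hκ`, BY VALUE) — ★ «D5» `UnitaryGroup.localCongr … S … v` is such a `κ`
(`localCongr_apply_eq_conj`).  NO definition is introduced.
* §2 `2 × 2` algebra at `n = 1`: `isSiegelM_one_iff` (`M ∈ P_Δ ↔ M₀₀ + M₀₁ = M₁₀ + M₁₁`), `detDeltaM_one_eq` (`det_Δ M = M₀₀ + M₀₁`), `map_bridge_rowsum` (row sums of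
  `S_R g S_R⁻¹` over any commutative `L`-algebra `R`: `g₀₀ ± ½ g₁₀`), `isUnit_apply_zero_zero_of_apply_one_zero` (`g₁₀ = 0 ⇒ g₀₀ ∈ Rˣ`),
  `map_bridgeMatrix_mem_glInt` (`S_w, S_w⁻¹ ∈ GL₂(𝒪_w)` at `|2|_w = 1`), `formCongr_bridge` (★ `bridge_congr` in ★ `formCongr` shape, the hypothesis of ★ `localCongr`).
* §3 THE DICTIONARY (place-`v` twins of ★ `isSiegelDelta_bridge_iff`, ★ `detDelta_bridge` + `K`-transport): `coe_apply_eq_conj_symm` (`h_w = S_w b_w S_w⁻¹`),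
  **`mem_siegelDeltaLoc_iff_symm_apply`** (`h ∈ P_Δ(L⁺_v) ↔ ∀ w ∣ v, (b_w)₁₀ = 0`), **`localDetDelta_eq_symm_apply`** (`det_Δ(h)_w = (b_w)₀₀`),
  **`localSiegelCharacter_eq_of_symm_apply`** (the inducing character of `I_v(σ, χ_v)` at `h` is `∏_w χ_w(u_w) · (∏_w ‖u_w‖_w)^{σ+½}`, `u_w = (b_w)₀₀` — the NORMALISED
  rank-one character of the Borel of `U(1,1)(L⁺_v)`), **`symm_apply_mem_localInt_iff`** (`b ∈ U(J)(𝒪_v) ↔ h ∈ H₁(𝒪_v)` when `|2|_w = 1` for all `w ∣ v`).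
* §5 `localCongr_apply_eq_conj` — ★ «D5» `localCongr … S … v` satisfies `hκ` (= ★ `coe_localCongr_apply_apply`, read on the doubled line).
[GelbartRogawski1991, §3.1], [Tan1999, §1], [MoeglinWaldspurger1995, I.1.4], [PlatonovRapinchuk1994, §2.3, §5.1], [HarrisKudlaSweet1996, §1 (1.15)].
HONEST LABEL.  Count-neutral helper: `HC_CM` is proved only modulo the 7 printed citations (2 remaining named inputs: hLiu418 = `stmt-HodgeConjecture-24832`,
h413 = `stmt-HodgeConjecture-24833`) until rung 0 closes.
-/

set_option autoImplicit false
set_option linter.dupNamespace false -- the mandated namespace repeats `HodgeConjecture.HodgeConjecture`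

noncomputable section

open scoped Matrix
open NumberField IsDedekindDomain
open Literature.NumberTheory.Automorphic Literature.NumberTheory.Automorphic.UnitaryGroup
open Literature.NumberTheory.GaloisRepresentations
open Literature.NumberTheory.GelbartRogawski1991 Literature.NumberTheory.GelbartRogawski1991.GRConstruction
open Literature.NumberTheory.GelbartRogawski1991.UnitaryDualPair
open Literature.NumberTheory.K2Lit.SiegelDoubled Literature.NumberTheory.K2Lit.LocalSiegelDoubled
open Summit.HodgeConjecture.HodgeConjecture.Cruxes.H413.K2E1BorelEisensteinU2FromK2Liu (bridge_congr gramR_one finSumFinEquiv_inl_zero finSumFinEquiv_inr_zero)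

namespace Summit.HodgeConjecture.HodgeConjecture.Cruxes.HLiu418.K2LiuLineBridgeLocalDictionary

/-! ## §2 `2 × 2` algebra at `n = 1`: the Siegel relation, `det_Δ`, the row sums of `S g S⁻¹`, integrality of `S` -/

section MatrixOne

/-- **`P_Δ` at `n = 1` in entries**: `M ∈ P_Δ ↔ M₀₀ + M₀₁ = M₁₀ + M₁₁` (★ `isSiegelM_iff_entry`; the two row sums agree: `M` stabilises `⟨(1,1)⟩`).
[cite: GelbartRogawski1991, §3.1] -/
theorem isSiegelM_one_iff {R : Type*} [CommRing R] (A : Matrix (Fin (1 + 1)) (Fin (1 + 1)) R) :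
    IsSiegelM A ↔ A 0 0 + A 0 1 = A 1 0 + A 1 1 := by
  rw [isSiegelM_iff_entry, Fin.forall_fin_one, Fin.forall_fin_one]
  simp only [e₂, finSumFinEquiv_inl_zero, finSumFinEquiv_inr_zero]

/-- **`det_Δ` at `n = 1` in entries**: `det_Δ M = M₀₀ + M₀₁`. [cite: GelbartRogawski1991, §3.1] -/
theorem detDeltaM_one_eq {R : Type*} [CommRing R] (A : Matrix (Fin (1 + 1)) (Fin (1 + 1)) R) : detDeltaM A = A 0 0 + A 0 1 := by
  unfold detDeltaM
  rw [Matrix.det_fin_one]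
  simp only [Matrix.add_apply, Matrix.toBlocks₁₁, Matrix.toBlocks₁₂, Matrix.reindex_apply, Matrix.submatrix_apply, Equiv.symm_symm,
    Matrix.of_apply, e₂, finSumFinEquiv_inl_zero, finSumFinEquiv_inr_zero]

variable (L : Type) [Field L] [NumberField L] [IsCMField L]

omit [IsCMField L] in
/-- **THE TWO ROW SUMS OF `S_R g S_R⁻¹` over any commutative `L`-algebra `R`** (`S = (1 ½; 1 −½)`, `S⁻¹ = (½ ½; 1 −1)` read through `f : L →+* R`):
`h₀₀ + h₀₁ = g₀₀ + f(½) g₁₀` and `h₁₀ + h₁₁ = g₀₀ − f(½) g₁₀` — the place-free form of ★ `bridge_rowsum`. [cite: PlatonovRapinchuk1994, §2.3] -/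
theorem map_bridge_rowsum (S : GL (Fin 2) L) (hS : (S : Matrix (Fin 2) (Fin 2) L) = !![1, 2⁻¹; 1, -2⁻¹])
    (hS' : ((S⁻¹ : GL (Fin 2) L) : Matrix (Fin 2) (Fin 2) L) = !![2⁻¹, 2⁻¹; 1, -1])
    {R : Type*} [CommRing R] (f : L →+* R) (g : GL (Fin 2) R) :
    ((Matrix.GeneralLinearGroup.map f S * g * (Matrix.GeneralLinearGroup.map f S)⁻¹ : GL (Fin 2) R) : Matrix (Fin 2) (Fin 2) R) 0 0 +
          ((Matrix.GeneralLinearGroup.map f S * g * (Matrix.GeneralLinearGroup.map f S)⁻¹ : GL (Fin 2) R) : Matrix (Fin 2) (Fin 2) R) 0 1 =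
        (g : Matrix (Fin 2) (Fin 2) R) 0 0 + f 2⁻¹ * (g : Matrix (Fin 2) (Fin 2) R) 1 0 ∧
      ((Matrix.GeneralLinearGroup.map f S * g * (Matrix.GeneralLinearGroup.map f S)⁻¹ : GL (Fin 2) R) : Matrix (Fin 2) (Fin 2) R) 1 0 +
          ((Matrix.GeneralLinearGroup.map f S * g * (Matrix.GeneralLinearGroup.map f S)⁻¹ : GL (Fin 2) R) : Matrix (Fin 2) (Fin 2) R) 1 1 =
        (g : Matrix (Fin 2) (Fin 2) R) 0 0 - f 2⁻¹ * (g : Matrix (Fin 2) (Fin 2) R) 1 0 := by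
  have ht : f 2⁻¹ + f 2⁻¹ = 1 := by
    rw [← map_add, show (2⁻¹ : L) + 2⁻¹ = 1 by norm_num, map_one]
  have h1 : ((Matrix.GeneralLinearGroup.map f S : GL (Fin 2) R) : Matrix (Fin 2) (Fin 2) R) = (!![1, 2⁻¹; 1, -2⁻¹] : Matrix (Fin 2) (Fin 2) L).map f := by
    rw [← hS]; rfl
  have h2 : (((Matrix.GeneralLinearGroup.map f S)⁻¹ : GL (Fin 2) R) : Matrix (Fin 2) (Fin 2) R) = (!![2⁻¹, 2⁻¹; 1, -1] : Matrix (Fin 2) (Fin 2) L).map f := by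
    rw [← Matrix.GeneralLinearGroup.map_inv, ← hS']; rfl
  simp only [Units.val_mul, h1, h2, Matrix.mul_apply, Fin.sum_univ_two, Matrix.map_apply, Matrix.of_apply, Matrix.cons_val', Matrix.cons_val_zero,
    Matrix.cons_val_one, Matrix.empty_val', Matrix.cons_val_fin_one, map_one, map_neg]
  constructor
  · linear_combination ((g : Matrix (Fin 2) (Fin 2) R) 0 0 + f 2⁻¹ * (g : Matrix (Fin 2) (Fin 2) R) 1 0) * ht
  · linear_combination ((g : Matrix (Fin 2) (Fin 2) R) 0 0 - f 2⁻¹ * (g : Matrix (Fin 2) (Fin 2) R) 1 0) * ht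

/-- **The corner entry of an invertible upper-triangular `2 × 2` matrix is a unit**: `g₁₀ = 0 ⇒ g₀₀ ∈ Rˣ` (`det g = g₀₀ g₁₁`). [folklore] -/
theorem isUnit_apply_zero_zero_of_apply_one_zero {R : Type*} [CommRing R] (g : GL (Fin 2) R) (hg : (g : Matrix (Fin 2) (Fin 2) R) 1 0 = 0) :
    IsUnit ((g : Matrix (Fin 2) (Fin 2) R) 0 0) := by
  have hdet : IsUnit (g : Matrix (Fin 2) (Fin 2) R).det := (Matrix.isUnit_iff_isUnit_det _).1 g.isUnit
  rw [Matrix.det_fin_two, hg, mul_zero, sub_zero] at hdet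
  exact isUnit_of_mul_isUnit_left hdet

omit [IsCMField L] in
/-- **`S_w, S_w⁻¹ ∈ GL₂(𝒪_w)` at a place with `|2|_w = 1`**: the entries `1, ±½, ±1` of `S` and `S⁻¹` are `w`-integral (★ `mem_glInt_iff`).
[cite: PlatonovRapinchuk1994, §5.1] -/
theorem map_bridgeMatrix_mem_glInt (S : GL (Fin 2) L) (hS : (S : Matrix (Fin 2) (Fin 2) L) = !![1, 2⁻¹; 1, -2⁻¹])
    (hS' : ((S⁻¹ : GL (Fin 2) L) : Matrix (Fin 2) (Fin 2) L) = !![2⁻¹, 2⁻¹; 1, -1])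
    (w : HeightOneSpectrum (𝓞 L)) (h2 : ValuativeRel.valuation (w.adicCompletion L) (2 : w.adicCompletion L) = 1) :
    Matrix.GeneralLinearGroup.map (algebraMap L (w.adicCompletion L)) S ∈ glInt 2 (w.adicCompletion L) := by
  have hhalf : ValuativeRel.valuation (w.adicCompletion L) (algebraMap L (w.adicCompletion L) 2⁻¹) ≤ 1 := by
    rw [map_inv₀, map_ofNat, map_inv₀, h2, inv_one]
  have hone : ValuativeRel.valuation (w.adicCompletion L) (algebraMap L (w.adicCompletion L) 1) ≤ 1 := by
    rw [map_one, map_one]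
  have hneg : ∀ x : L, ValuativeRel.valuation (w.adicCompletion L) (algebraMap L (w.adicCompletion L) (-x)) =
      ValuativeRel.valuation (w.adicCompletion L) (algebraMap L (w.adicCompletion L) x) := by
    intro x; rw [map_neg, Valuation.map_neg]
  have hcoe : ((Matrix.GeneralLinearGroup.map (algebraMap L (w.adicCompletion L)) S : GL (Fin 2) (w.adicCompletion L)) :
      Matrix (Fin 2) (Fin 2) (w.adicCompletion L)) = (!![1, 2⁻¹; 1, -2⁻¹] : Matrix (Fin 2) (Fin 2) L).map (algebraMap L (w.adicCompletion L)) := by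
    rw [← hS]; rfl
  have hcoe' : (((Matrix.GeneralLinearGroup.map (algebraMap L (w.adicCompletion L)) S)⁻¹ : GL (Fin 2) (w.adicCompletion L)) :
      Matrix (Fin 2) (Fin 2) (w.adicCompletion L)) = (!![2⁻¹, 2⁻¹; 1, -1] : Matrix (Fin 2) (Fin 2) L).map (algebraMap L (w.adicCompletion L)) := by
    rw [← Matrix.GeneralLinearGroup.map_inv, ← hS']; rfl
  rw [mem_glInt_iff]
  refine ⟨fun i j => ?_, fun i j => ?_⟩
  · rw [Valuation.mem_integer_iff, hcoe, Matrix.map_apply]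
    fin_cases i <;> fin_cases j
    · simp
    · simpa using hhalf
    · simp
    · rw [show (!![1, 2⁻¹; 1, -2⁻¹] : Matrix (Fin 2) (Fin 2) L) ⟨1, by norm_num⟩ ⟨1, by norm_num⟩ = -2⁻¹ from rfl, hneg]
      exact hhalf
  · rw [Valuation.mem_integer_iff, hcoe', Matrix.map_apply]
    fin_cases i <;> fin_cases j
    · simpa using hhalf
    · simpa using hhalf
    · simp
    · rw [show (!![2⁻¹, 2⁻¹; 1, -1] : Matrix (Fin 2) (Fin 2) L) ⟨1, by norm_num⟩ ⟨1, by norm_num⟩ = -1 from rfl, hneg]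
      exact hone

/-- **The line congruence in ★ `formCongr` shape**: `c(S)ᵀ · (1 • diag(1,−1)) · S = antidiag(1,1)` (★ `bridge_congr`), the hypothesis of ★ «D5»
`UnitaryGroup.localCongr` with scale `a = 1`.  The scalar action is written at the index type `Fin 2` of `S` (as ★ `localCongr` elaborates it), so that
feeding it to `localCongr` is a syntactic match (the doubled form `hermD` is natively indexed by `Fin (1 + 1)`). [cite: PlatonovRapinchuk1994, §2.3] -/
theorem formCongr_bridge (S : GL (Fin 2) L) (hS : (S : Matrix (Fin 2) (Fin 2) L) = !![1, 2⁻¹; 1, -2⁻¹]) :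
    formCongr (IsCMField.complexConj L : L →+* L) S
        (@HSMul.hSMul L (Matrix (Fin 2) (Fin 2) L) (Matrix (Fin 2) (Fin 2) L) instHSMul (1 : L)
          (hermD L (Equiv.prodUnique (Fin 1) (Fin 1)) (fun _ => (1 : L)) (fun _ => map_one _) (fun _ => (1 : L)) (fun _ => map_one _))) =
      (Matrix.of fun i j : Fin 2 => if i.val + j.val + 1 = 2 then (1 : L) else 0) := by
  rw [one_smul]
  exact bridge_congr L S hS

end MatrixOne

/-! ## §3 The local line-bridge dictionary for a bridge `κ : U(J)(L⁺_v) ≃ₜ* H₁(L⁺_v)`, `κ(x)_w = S_w x_w S_w⁻¹` (BY VALUE), read on `h ∈ H₁(L⁺_v)` -/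

section Bridge

variable (L : Type) [Field L] [NumberField L] [IsCMField L] (v : HeightOneSpectrum (𝓞 (Fp L)))
  (S : GL (Fin 2) L) (hS : (S : Matrix (Fin 2) (Fin 2) L) = !![1, 2⁻¹; 1, -2⁻¹])
  (hS' : ((S⁻¹ : GL (Fin 2) L) : Matrix (Fin 2) (Fin 2) L) = !![2⁻¹, 2⁻¹; 1, -1])
  {J : Matrix (Fin 2) (Fin 2) L}
  (κ : UnitaryGroup.localPi L (IsCMField.complexConj L) 2 J v ≃ₜ* UnitaryGroup.localPi L (IsCMField.complexConj L) (1 + 1)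
      (hermD L (Equiv.prodUnique (Fin 1) (Fin 1)) (fun _ => (1 : L)) (fun _ => map_one _) (fun _ => (1 : L)) (fun _ => map_one _)) v)
  (hκ : ∀ (x : UnitaryGroup.localPi L (IsCMField.complexConj L) 2 J v) (w : UnitaryGroup.PlacesOver L v),
    (κ x : UnitaryGroup.LocalGLPi L (1 + 1) v) w =
      Matrix.GeneralLinearGroup.map (algebraMap L (w.1.adicCompletion L)) S * (x : UnitaryGroup.LocalGLPi L 2 v) w *
        (Matrix.GeneralLinearGroup.map (algebraMap L (w.1.adicCompletion L)) S)⁻¹)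
  (χ : HeckeCharacter L) (σ : ℂ) (h : UnitaryGroup.localPi L (IsCMField.complexConj L) (1 + 1)
      (hermD L (Equiv.prodUnique (Fin 1) (Fin 1)) (fun _ => (1 : L)) (fun _ => map_one _) (fun _ => (1 : L)) (fun _ => map_one _)) v) (u : ∀ w : UnitaryGroup.PlacesOver L v, (w.1.adicCompletion L)ˣ)
  (hb : ∀ w : UnitaryGroup.PlacesOver L v,
    (((κ.symm h : UnitaryGroup.LocalGLPi L 2 v) w : GL (Fin 2) (w.1.adicCompletion L)) : Matrix (Fin 2) (Fin 2) (w.1.adicCompletion L)) 1 0 = 0)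
  (hu : ∀ w : UnitaryGroup.PlacesOver L v, (u w : w.1.adicCompletion L) =
    (((κ.symm h : UnitaryGroup.LocalGLPi L 2 v) w : GL (Fin 2) (w.1.adicCompletion L)) : Matrix (Fin 2) (Fin 2) (w.1.adicCompletion L)) 0 0)

include hκ in
/-- The `w`-component of `h ∈ H₁(L⁺_v)` is `S_w b_w S_w⁻¹` for `b = κ⁻¹ h` (`hκ` at `κ b = h`). [cite: PlatonovRapinchuk1994, §2.3] -/
theorem coe_apply_eq_conj_symm (w : UnitaryGroup.PlacesOver L v) :
    (h : UnitaryGroup.LocalGLPi L (1 + 1) v) w =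
      Matrix.GeneralLinearGroup.map (algebraMap L (w.1.adicCompletion L)) S * ((κ.symm h : UnitaryGroup.LocalGLPi L 2 v) w) *
        (Matrix.GeneralLinearGroup.map (algebraMap L (w.1.adicCompletion L)) S)⁻¹ := by
  have e := hκ (κ.symm h) w
  rw [ContinuousMulEquiv.apply_symm_apply] at e
  exact e

include hS hS' hκ in
/-- **BOREL `↦` SIEGEL PARABOLIC, locally**: `h ∈ P_Δ(L⁺_v) ↔ (b_w)₁₀ = 0` for every `w ∣ v`, `b = κ⁻¹ h` — the place-`v` twin of ★ `isSiegelDelta_bridge_iff`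
(★ `mem_siegelDeltaLoc_iff_isSiegelM` + `map_bridge_rowsum`). [cite: GelbartRogawski1991, §3.1] [cite: Tan1999, §1] -/
theorem mem_siegelDeltaLoc_iff_symm_apply :
    h ∈ siegelDeltaLoc L (Equiv.prodUnique (Fin 1) (Fin 1)) (fun _ => (1 : L)) (fun _ => map_one _) (fun _ => (1 : L)) (fun _ => map_one _) v ↔
      ∀ w : UnitaryGroup.PlacesOver L v,
        (((κ.symm h : UnitaryGroup.LocalGLPi L 2 v) w : GL (Fin 2) (w.1.adicCompletion L)) : Matrix (Fin 2) (Fin 2) (w.1.adicCompletion L)) 1 0 = 0 := by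
  rw [mem_siegelDeltaLoc_iff_isSiegelM]
  refine forall_congr' fun w => ?_
  set g : GL (Fin 2) (w.1.adicCompletion L) := (κ.symm h : UnitaryGroup.LocalGLPi L 2 v) w with hg
  have ht : algebraMap L (w.1.adicCompletion L) 2⁻¹ + algebraMap L (w.1.adicCompletion L) 2⁻¹ = 1 := by
    rw [← map_add, show (2⁻¹ : L) + 2⁻¹ = 1 by norm_num, map_one]
  obtain ⟨h1, h2⟩ := map_bridge_rowsum L S hS hS' (algebraMap L (w.1.adicCompletion L)) g
  set A : Matrix (Fin 2) (Fin 2) (w.1.adicCompletion L) := ((Matrix.GeneralLinearGroup.map (algebraMap L (w.1.adicCompletion L)) S * g *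
    (Matrix.GeneralLinearGroup.map (algebraMap L (w.1.adicCompletion L)) S)⁻¹ : GL (Fin 2) (w.1.adicCompletion L)) :
      Matrix (Fin 2) (Fin 2) (w.1.adicCompletion L)) with hA
  have key : A 0 0 + A 0 1 = A 1 0 + A 1 1 ↔ (g : Matrix (Fin 2) (Fin 2) (w.1.adicCompletion L)) 1 0 = 0 := by
    rw [h1, h2]
    constructor
    · intro h3
      have h4 : (algebraMap L (w.1.adicCompletion L) 2⁻¹ + algebraMap L (w.1.adicCompletion L) 2⁻¹) * (g : Matrix (Fin 2) (Fin 2) (w.1.adicCompletion L)) 1 0 = 0 := by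
        linear_combination h3
      rwa [ht, one_mul] at h4
    · intro h3
      rw [h3, mul_zero, add_zero, sub_zero]
  rw [isSiegelM_one_iff, coe_apply_eq_conj_symm L v S κ hκ h w]
  exact key

include hS hS' hκ hb in
/-- **`det_Δ(h)_w = (b_w)₀₀` ON THE BOREL** (`b = κ⁻¹ h`, `(b_w)₁₀ = 0`) — the place-`v` twin of ★ `detDelta_bridge`: `h` acts on `Δ_w ≅ L_w` by `(b_w)₀₀`.
[cite: Tan1999, §1] [cite: MoeglinWaldspurger1995, I.1.4] -/
theorem localDetDelta_eq_symm_apply (w : UnitaryGroup.PlacesOver L v) :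
    LocalSplitting.detDelta (Fp L) L (IsCMField.complexConj L) v 1 w h =
      (((κ.symm h : UnitaryGroup.LocalGLPi L 2 v) w : GL (Fin 2) (w.1.adicCompletion L)) : Matrix (Fin 2) (Fin 2) (w.1.adicCompletion L)) 0 0 := by
  set g : GL (Fin 2) (w.1.adicCompletion L) := (κ.symm h : UnitaryGroup.LocalGLPi L 2 v) w with hg
  obtain ⟨h1, -⟩ := map_bridge_rowsum L S hS hS' (algebraMap L (w.1.adicCompletion L)) g
  have hb' : (g : Matrix (Fin 2) (Fin 2) (w.1.adicCompletion L)) 1 0 = 0 := by rw [hg]; exact hb w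
  set A : Matrix (Fin 2) (Fin 2) (w.1.adicCompletion L) := ((Matrix.GeneralLinearGroup.map (algebraMap L (w.1.adicCompletion L)) S * g *
    (Matrix.GeneralLinearGroup.map (algebraMap L (w.1.adicCompletion L)) S)⁻¹ : GL (Fin 2) (w.1.adicCompletion L)) :
      Matrix (Fin 2) (Fin 2) (w.1.adicCompletion L)) with hA
  have key : A 0 0 + A 0 1 = (g : Matrix (Fin 2) (Fin 2) (w.1.adicCompletion L)) 0 0 := by rw [h1, hb', mul_zero, add_zero]
  rw [localDetDelta_eq_detDeltaM L (Equiv.prodUnique (Fin 1) (Fin 1)) (fun _ => (1 : L)) (fun _ => map_one _) (fun _ => (1 : L)) (fun _ => map_one _) v w,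
    detDeltaM_one_eq, coe_apply_eq_conj_symm L v S κ hκ h w]
  exact key

include hS hS' hκ hb hu in
/-- **THE INDUCING CHARACTER OF `I_v(σ, χ_v)` ON THE BOREL**: for `b = κ⁻¹ h` with `(b_w)₁₀ = 0` and `u_w = (b_w)₀₀ ∈ L_wˣ`,
`χ_v(det_Δ h)·|det_Δ h|_v^{σ + 1/2} = ∏_{w∣v} χ_w(u_w) · (∏_{w∣v} ‖u_w‖_w)^{σ + 1/2}` (★ D1 `localSiegelCharacter` at `n = 1`) — the NORMALISED rank-one character of the
Borel of `U(1,1)(L⁺_v)`: the local Borel law a FILE-B unfolding produces IS the Siegel law through `κ`. [cite: Tan1999, §1] [cite: HarrisKudlaSweet1996, §1 (1.15)] -/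
theorem localSiegelCharacter_eq_of_symm_apply :
    haveI : Algebra.IsQuadraticExtension (Fp L) L := IsCMField.isQuadraticExtension L
    localSiegelCharacter (Fp L) L (IsCMField.complexConj L) v 1 (fun w => χ.localComponent w.1) σ h =
      (∏ w : UnitaryGroup.PlacesOver L v, ((χ.localComponent w.1 (u w) : ℂˣ) : ℂ)) *
        (((∏ w : UnitaryGroup.PlacesOver L v, ‖(u w : w.1.adicCompletion L)‖ : ℝ) : ℂ) ^ (σ + 1 / 2)) := by
  haveI : Algebra.IsQuadraticExtension (Fp L) L := IsCMField.isQuadraticExtension L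
  have hdet : ∀ w : UnitaryGroup.PlacesOver L v,
      LocalSplitting.detDelta (Fp L) L (IsCMField.complexConj L) v 1 w h = (u w : w.1.adicCompletion L) := fun w => by
    rw [localDetDelta_eq_symm_apply L v S hS hS' κ hκ h hb w, hu w]
  have hunit : ∀ w : UnitaryGroup.PlacesOver L v, IsUnit (LocalSplitting.detDelta (Fp L) L (IsCMField.complexConj L) v 1 w h) :=
    fun w => (hdet w) ▸ (u w).isUnit
  have hunit' : ∀ w : UnitaryGroup.PlacesOver L v, (hunit w).unit = u w := fun w => Units.ext (by rw [IsUnit.unit_spec, hdet])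
  have hchi : ((LocalSplitting.chiDet (Fp L) L (IsCMField.complexConj L) v 1 (fun w => χ.localComponent w.1) h : ℂˣ) : ℂ) =
      ∏ w : UnitaryGroup.PlacesOver L v, ((χ.localComponent w.1 (u w) : ℂˣ) : ℂ) := by
    rw [LocalSplitting.chiDet, Units.coe_prod]
    exact Finset.prod_congr rfl fun w _ => by rw [dif_pos (hunit w), hunit' w]
  have habs : absDetDelta (Fp L) L (IsCMField.complexConj L) v 1 h = ∏ w : UnitaryGroup.PlacesOver L v, ‖(u w : w.1.adicCompletion L)‖ := by
    simp only [absDetDelta, hdet]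
  rw [localSiegelCharacter, hchi, habs, Nat.cast_one]

include hS hS' hκ in
/-- **`K ↦ K`**: at a place with `|2|_w = 1` for every `w ∣ v`, `κ⁻¹ h ∈ U(J)(𝒪_v) ↔ h ∈ H₁(𝒪_v)` (`S_w, S_w⁻¹ ∈ GL₂(𝒪_w)`, `map_bridgeMatrix_mem_glInt`; the
place-`v` case of ★ (P2) `eventually_localCongr_mem_localInt_iff` with the exceptional set made explicit: `v ∣ 2`). [cite: PlatonovRapinchuk1994, §5.1] -/
theorem symm_apply_mem_localInt_iff
    (h2 : ∀ w : UnitaryGroup.PlacesOver L v, ValuativeRel.valuation (w.1.adicCompletion L) (2 : w.1.adicCompletion L) = 1) :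
    κ.symm h ∈ UnitaryGroup.localInt L (IsCMField.complexConj L) 2 J v ↔
      h ∈ UnitaryGroup.localInt L (IsCMField.complexConj L) (1 + 1) (hermD L (Equiv.prodUnique (Fin 1) (Fin 1)) (fun _ => (1 : L)) (fun _ => map_one _) (fun _ => (1 : L)) (fun _ => map_one _)) v := by
  have hSw : ∀ w : UnitaryGroup.PlacesOver L v,
      Matrix.GeneralLinearGroup.map (algebraMap L (w.1.adicCompletion L)) S ∈ glInt 2 (w.1.adicCompletion L) :=
    fun w => map_bridgeMatrix_mem_glInt L S hS hS' w.1 (h2 w)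
  rw [UnitaryGroup.mem_localInt_iff, UnitaryGroup.mem_localInt_iff]
  refine forall_congr' fun w => ?_
  set g : GL (Fin 2) (w.1.adicCompletion L) := (κ.symm h : UnitaryGroup.LocalGLPi L 2 v) w with hg
  have key : g ∈ glInt 2 (w.1.adicCompletion L) ↔ Matrix.GeneralLinearGroup.map (algebraMap L (w.1.adicCompletion L)) S * g *
      (Matrix.GeneralLinearGroup.map (algebraMap L (w.1.adicCompletion L)) S)⁻¹ ∈ glInt 2 (w.1.adicCompletion L) := by
    constructor
    · intro hw
      exact Subgroup.mul_mem _ (Subgroup.mul_mem _ (hSw w) hw) (Subgroup.inv_mem _ (hSw w))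
    · intro hw
      have h3 := Subgroup.mul_mem _ (Subgroup.mul_mem _ (Subgroup.inv_mem _ (hSw w)) hw) (hSw w)
      simpa only [mul_assoc, mul_inv_cancel_left, inv_mul_cancel, mul_one, inv_mul_cancel_left] using h3
  rw [coe_apply_eq_conj_symm L v S κ hκ h w]
  exact key

end Bridge

/-! ## §5 The bridge of record: ★ «D5» `Ψ_{S,v} = UnitaryGroup.localCongr … S … v` satisfies `hκ` -/

section LocalCongr

variable (L : Type) [Field L] [NumberField L] [IsCMField L] (v : HeightOneSpectrum (𝓞 (Fp L)))
  (S : GL (Fin 2) L) (hS : (S : Matrix (Fin 2) (Fin 2) L) = !![1, 2⁻¹; 1, -2⁻¹])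
  (hS' : ((S⁻¹ : GL (Fin 2) L) : Matrix (Fin 2) (Fin 2) L) = !![2⁻¹, 2⁻¹; 1, -1])
  {J : Matrix (Fin 2) (Fin 2) L}
  (hc : formCongr (IsCMField.complexConj L : L →+* L) S
    (@HSMul.hSMul L (Matrix (Fin 2) (Fin 2) L) (Matrix (Fin 2) (Fin 2) L) instHSMul (1 : L) (hermD L (Equiv.prodUnique (Fin 1) (Fin 1)) (fun _ => (1 : L)) (fun _ => map_one _) (fun _ => (1 : L)) (fun _ => map_one _))) = J)

/-- **★ «D5» `Ψ_{S,v} = localCongr … S … v : U(J)(L⁺_v) ≃ₜ* H₁(L⁺_v)` IS a bridge as in §3**: its components are `S_w x_w S_w⁻¹` (★ `coe_localCongr_apply_apply`),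
read on the doubled line.  The congruence binder `hc` is ★ `bridge_congr` in ★ `formCongr` shape (the scalar action written at the index type `Fin 2` of `S`, as
★ `localCongr` elaborates it) — `formCongr_bridge L S hS` at the route's literal `J = antidiag(1,1)`. [cite: PlatonovRapinchuk1994, §2.3] -/
theorem localCongr_apply_eq_conj (x : UnitaryGroup.localPi L (IsCMField.complexConj L) 2 J v) (w : UnitaryGroup.PlacesOver L v) :
    (((UnitaryGroup.localCongr L (IsCMField.complexConj L) S one_ne_zero hc v :) x : UnitaryGroup.localPi L (IsCMField.complexConj L) (1 + 1)
      (hermD L (Equiv.prodUnique (Fin 1) (Fin 1)) (fun _ => (1 : L)) (fun _ => map_one _) (fun _ => (1 : L)) (fun _ => map_one _)) v) : UnitaryGroup.LocalGLPi L (1 + 1) v) w =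
      Matrix.GeneralLinearGroup.map (algebraMap L (w.1.adicCompletion L)) S * (x : UnitaryGroup.LocalGLPi L 2 v) w *
        (Matrix.GeneralLinearGroup.map (algebraMap L (w.1.adicCompletion L)) S)⁻¹ :=
  coe_localCongr_apply_apply L (IsCMField.complexConj L) S one_ne_zero hc v x w

end LocalCongr

end Summit.HodgeConjecture.HodgeConjecture.Cruxes.HLiu418.K2LiuLineBridgeLocalDictionary

end
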